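import Summits.Ventures.QEC.Census.BB.A1s_n28_k6_9010d387
import Summits.Ventures.QEC.Census.BB.BBRows
import Summits.Ventures.QEC.Census.BB.Claims
import Literature.InformationTheory.QuantumCodes.TwoBlockConnectedComponents
import Literature.InformationTheory.QuantumCodes.TwoBlockToricLayout
import Literature.InformationTheory.QuantumCodes.TwoBlockWheelComponents
import HarnessLib
import HarnessLib.Audit.Tags
import Summits.Ventures.QEC.Census.BB.A1s_n30_k8_9dee8b31
import Summits.Ventures.QEC.Census.BB.A1s_n36_k4_28cc91ab

/-!
# Census rows as TYPED two-block codes `QC(A, B)` on `ℤ_ℓ × ℤ_m` — bridge batch `A1sRowsQC2` (3 row(s), kernel tier)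

Family: BB (cell A.1 leaders; qec-search-3 sweep, qec-search-7 one-module certificates). For each KERNEL-std census row below (an EXPLICIT matrix code
`cert.code _ = CSSCode.ofMatrices (rowMatrix n cert.HX) (rowMatrix n cert.HZ)` with `IsCode n k d` certified in its own module), this file
puts the row's CONSTRUCTION into the kernel statement, as in the pilot `Census/BB/A1s_n144_k32_4addf704QC.lean` (p511732):
monomial lists `la`, `lb` (from the certificate's `code.construction`, monomials `xⁱyʲ` as `[i,j]`, convention of BCGMRY24 §4 =
`BivariateBicycleCodes.lean`), the typed object `qc : BB.Code ℓ m := ⟨polyL la, polyL lb⟩`, the kernel INDEX IDENTITIES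
`cert.HX = BBRows.rowsX la lb`, `cert.HZ = BBRows.rowsZ la lb` (`decide`; verified row generator `Census/BB/BBRows.lean`, p502918), the flat
identities via `BBRows.rowMatrix_rowsX/Z`, the transport of the row's own `dZ_eq` / `k_eq` by type-05's `BB.Code.dZ_eq_of_flat` /
`k_eq_of_flat` to `qc_hasParams : BB.HasParams qc n k d` (census predicate of family BB, `Census/BB/Claims.lean`, distance EXACT) and
`qc_isCode : qc.css.IsCode n k d`; and the census LAYOUT columns (Bravyi et al. 2024 §5) as KERNEL verdicts: «connected» —
`qc_tannerGraph_connected` (Lemma 3, `BB.Code.tannerGraph_connected_of_unit_mem`, explicit multiples of exponent differences) or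
`qc_tannerGraph_not_connected` + `card_expDiffSubgroup` + `qc_card_connectedComponent` (`⟨S⟩` = an explicit finite carrier `diffList`,
both inclusions certified; exact component count by Lemma 3 (ii), `BB.Code.card_connectedComponent_mul_card`; by the tree's connected
normal form `TwoBlockConnectedComponents.lean` such a code is the disjoint union of that many copies of its root code); «toric layout» —
`qc_hasToricLayoutWith μ λ` (Lemma 4, `BB.Code.hasToricLayoutWith_of_exponents`; omitted when its sufficient condition has no witness);
«wheel layers» — `qc_wheel_layers` (Lemma 2 minus planarity, `BB.Code.exists_wheel_layers`, weight-(3,3) rows only):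

* `A1s_n28_k6_9010d387` = `QC(y + y^3 + x, 1 + y^2 + y^6)` on `ℤ_2 × ℤ_7`: `[[28, 6, 4]]`; Tanner graph connected; wheel layers 28/14
* `A1s_n30_k8_9dee8b31` = `QC(y + y^4 + x^2, y^2 + y^3 + x)` on `ℤ_3 × ℤ_5`: `[[30, 8, 4]]`; Tanner graph connected; wheel layers 30/10
* `A1s_n36_k4_28cc91ab` = `QC(y + y^5 + x, y^7 + y^8 + x)` on `ℤ_2 × ℤ_9`: `[[36, 4, 6]]`; Tanner graph connected; wheel layers 36/18

No new certificate — tier KERNEL, axioms standard, no `native_decide`. HONEST FRAMING: identifies already-certified census objects with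
named algebraic constructions and decides structural (graph) properties; the census comparator columns (printed values, optimality
words) are not touched; «= c × [[n/c, k/c, d]]» is the numerical reading of the certified component count (the per-component code is
identified by the normal form; its own parameters are not re-certified here); planarity/thickness is not asserted. Generated by
qec-type-05's `tools/emit_qc_bridge.py` + `tools/conn_cert.py` (HOME/lean/type-05/tools/).
-/

namespace Summit.Ventures.QEC.Census.A1s_n28_k6_9010d387

open Matrix Literature.InformationTheory.QuantumCodes BBRows

/-- Monomials of `A = y + y^3 + x` (certificate `A_terms = [[0, 1], [0, 3], [1, 0]]`). DATA. -/
def la : List (BB.Mono 2 7) := [(Fin.ofNat 2 0, Fin.ofNat 7 1), (Fin.ofNat 2 0, Fin.ofNat 7 3), (Fin.ofNat 2 1, Fin.ofNat 7 0)]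

/-- Monomials of `B = 1 + y^2 + y^6` (certificate `B_terms = [[0, 0], [0, 2], [0, 6]]`). DATA. -/
def lb : List (BB.Mono 2 7) := [(Fin.ofNat 2 0, Fin.ofNat 7 0), (Fin.ofNat 2 0, Fin.ofNat 7 2), (Fin.ofNat 2 0, Fin.ofNat 7 6)]

/-- The census row's code as a TYPED two-block code `QC(y + y^3 + x, 1 + y^2 + y^6)` on `ℤ_2 × ℤ_7` (`BB.Code 2 7`). (definition) -/
def qc : BB.Code 2 7 := ⟨polyL la, polyL lb⟩

set_option maxRecDepth 100000 in
/-- INDEX IDENTITY, `X` side, in the kernel: the certificate's `H^X` rows ARE the `X`-check words of `qc` (`decide +kernel`). -/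
theorem HX_eq_rowsX : A1s_n28_k6_9010d387.cert.HX = rowsX la lb := by
  decide +kernel

set_option maxRecDepth 100000 in
/-- INDEX IDENTITY, `Z` side. -/
theorem HZ_eq_rowsZ : A1s_n28_k6_9010d387.cert.HZ = rowsZ la lb := by
  decide +kernel

set_option maxRecDepth 100000 in
/-- The certificate's flat `H^X` is `qc.HXFlat`. -/
theorem rowMatrix_HX_eq : rowMatrix 28 A1s_n28_k6_9010d387.cert.HX = qc.HXFlat := by
  have cast : ∀ {H H' : List ℕ} (e : H = H'),
      rowMatrix 28 H = (rowMatrix 28 H').submatrix (Fin.cast (congrArg List.length e)) id := by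
    intro H H' e; subst e; rfl
  exact (cast HX_eq_rowsX).trans (rowMatrix_rowsX qc (LA := la) (LB := lb) rfl rfl)

set_option maxRecDepth 100000 in
/-- The certificate's flat `H^Z` is `qc.HZFlat`. -/
theorem rowMatrix_HZ_eq : rowMatrix 28 A1s_n28_k6_9010d387.cert.HZ = qc.HZFlat := by
  have cast : ∀ {H H' : List ℕ} (e : H = H'),
      rowMatrix 28 H = (rowMatrix 28 H').submatrix (Fin.cast (congrArg List.length e)) id := by
    intro H H' e; subst e; rfl
  exact (cast HZ_eq_rowsZ).trans (rowMatrix_rowsZ qc (LA := la) (LB := lb) rfl rfl)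

set_option maxRecDepth 100000 in
/-- `d^Z (qc) = 4`, transported from the census certificate (`A1s_n28_k6_9010d387.dZ_eq`) by `BB.Code.dZ_eq_of_flat`. -/
theorem qc_dZ : qc.css.dZ = 4 :=
  (qc.dZ_eq_of_flat (D := A1s_n28_k6_9010d387.cert.code A1s_n28_k6_9010d387.commOK_cert)
    rowMatrix_HX_eq rowMatrix_HZ_eq).symm.trans A1s_n28_k6_9010d387.dZ_eq

set_option maxRecDepth 100000 in
/-- `k (qc) = 6`, transported from the census certificate (`A1s_n28_k6_9010d387.k_eq`) by `BB.Code.k_eq_of_flat`. -/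
theorem qc_k : qc.k = 6 :=
  (qc.k_eq_of_flat (D := A1s_n28_k6_9010d387.cert.code A1s_n28_k6_9010d387.commOK_cert)
    rowMatrix_HX_eq rowMatrix_HZ_eq).symm.trans A1s_n28_k6_9010d387.k_eq

/-- **`QC(y + y^3 + x, 1 + y^2 + y^6)` on `ℤ_2 × ℤ_7` has parameters `[[28, 6, 4]]`** (distance exact; `BB.HasParams`) — the census row
`A1s_n28_k6_9010d387` read as a statement about the construction. KERNEL. -/
theorem qc_hasParams : Summit.Ventures.QEC.BB.HasParams qc 28 6 4 :=
  BB.hasParams_of_dZ (by simp only [BB.numQubits_eq]) qc_k qc_dZ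

/-- The same in the generic census vocabulary: `qc.css.IsCode 28 6 4`. -/
theorem qc_isCode : qc.css.IsCode 28 6 4 :=
  (BB.hasParams_iff_isCode (by decide)).1 qc_hasParams


set_option maxRecDepth 100000 in
/-- **The Tanner graph of `qc` is connected** (Bravyi et al. 2024 Lemma 3 / `BB.Code.tannerGraph_connected_of_unit_mem`): `x = (1,0)`
and `y = (0,1)` are explicit combinations of exponent differences inside `A` or inside `B` (found by qec-type-05's tools/conn_cert.py,
re-checked by `decide`). Census column «connected» for this row, KERNEL. -/
theorem qc_tannerGraph_connected : qc.css.tannerGraph.Connected := by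
  refine qc.tannerGraph_connected_of_unit_mem (fun h => absurd (congrFun h ((0 : Fin 2), (1 : Fin 7))) (by decide))
    (fun h => absurd (congrFun h ((0 : Fin 2), (0 : Fin 7))) (by decide)) ?_ ?_
  · have e : (((1 : Fin 2), (0 : Fin 7)) : BB.Mono 2 7) = (7 : ℕ) • (((0 : Fin 2), (1 : Fin 7)) - (1, 0)) := by decide
    rw [e]
    exact (AddSubgroup.nsmul_mem _ (qc.sub_mem_expDiffSubgroup_A (by decide) (by decide)) 7)
  · have e : (((0 : Fin 2), (1 : Fin 7)) : BB.Mono 2 7) = (3 : ℕ) • (((0 : Fin 2), (1 : Fin 7)) - (0, 3)) := by decide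
    rw [e]
    exact (AddSubgroup.nsmul_mem _ (qc.sub_mem_expDiffSubgroup_A (by decide) (by decide)) 3)

set_option maxRecDepth 100000 in
/-- **`qc`**: Tanner graph = edge-disjoint union of two layers whose components are wheel graphs `prismGraph 28` (`A₃A₂ᵀ` of order
`14`) and `prismGraph 14` (`B₂B₁ᵀ` of order `7`) — BCGMRY24 Lemma 2 minus planarity (`BB.Code.exists_wheel_layers`). KERNEL. -/
theorem qc_wheel_layers :
    ∃ ΓA ΓB : SimpleGraph ((BB.Mono 2 7 ⊕ BB.Mono 2 7) ⊕ (BB.Mono 2 7 ⊕ BB.Mono 2 7)),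
    qc.css.tannerGraph = ΓA ⊔ ΓB ∧ Disjoint ΓA ΓB ∧
    (∀ K : ΓA.ConnectedComponent, Nonempty (K.toSimpleGraph ≃g prismGraph 28)) ∧
    (∀ K : ΓB.ConnectedComponent, Nonempty (K.toSimpleGraph ≃g prismGraph 14)) := by
  have hA : ∀ g : BB.Mono 2 7, qc.A g ≠ 0 ↔ g = ((0 : Fin 2), (1 : Fin 7)) ∨ g = ((0 : Fin 2), (3 : Fin 7)) ∨ g = ((1 : Fin 2), (0 : Fin 7)) := by decide +kernel
  have hB : ∀ g : BB.Mono 2 7, qc.B g ≠ 0 ↔ g = ((0 : Fin 2), (0 : Fin 7)) ∨ g = ((0 : Fin 2), (2 : Fin 7)) ∨ g = ((0 : Fin 2), (6 : Fin 7)) := by decide +kernel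
  have h := qc.exists_wheel_layers (g₁ := ((0 : Fin 2), (1 : Fin 7))) (g₂ := ((0 : Fin 2), (3 : Fin 7))) (g₃ := ((1 : Fin 2), (0 : Fin 7))) (h₁ := ((0 : Fin 2), (0 : Fin 7)))
    (h₂ := ((0 : Fin 2), (2 : Fin 7))) (h₃ := ((0 : Fin 2), (6 : Fin 7))) (by decide) (by decide) (by decide) (by decide) (by decide) (by decide) hA hB
  have e1 : addOrderOf (((1 : Fin 2), (0 : Fin 7)) - (0, 3)) = 14 := (addOrderOf_eq_iff (by norm_num)).mpr (by decide)
  have e2 : addOrderOf (((0 : Fin 2), (2 : Fin 7)) - (0, 0)) = 7 := (addOrderOf_eq_iff (by norm_num)).mpr (by decide)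
  rw [e1, e2] at h
  exact h

end Summit.Ventures.QEC.Census.A1s_n28_k6_9010d387

namespace Summit.Ventures.QEC.Census.A1s_n30_k8_9dee8b31

open Matrix Literature.InformationTheory.QuantumCodes BBRows

/-- Monomials of `A = y + y^4 + x^2` (certificate `A_terms = [[0, 1], [0, 4], [2, 0]]`). DATA. -/
def la : List (BB.Mono 3 5) := [(Fin.ofNat 3 0, Fin.ofNat 5 1), (Fin.ofNat 3 0, Fin.ofNat 5 4), (Fin.ofNat 3 2, Fin.ofNat 5 0)]

/-- Monomials of `B = y^2 + y^3 + x` (certificate `B_terms = [[0, 2], [0, 3], [1, 0]]`). DATA. -/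
def lb : List (BB.Mono 3 5) := [(Fin.ofNat 3 0, Fin.ofNat 5 2), (Fin.ofNat 3 0, Fin.ofNat 5 3), (Fin.ofNat 3 1, Fin.ofNat 5 0)]

/-- The census row's code as a TYPED two-block code `QC(y + y^4 + x^2, y^2 + y^3 + x)` on `ℤ_3 × ℤ_5` (`BB.Code 3 5`). (definition) -/
def qc : BB.Code 3 5 := ⟨polyL la, polyL lb⟩

set_option maxRecDepth 100000 in
/-- INDEX IDENTITY, `X` side, in the kernel: the certificate's `H^X` rows ARE the `X`-check words of `qc` (`decide +kernel`). -/
theorem HX_eq_rowsX : A1s_n30_k8_9dee8b31.cert.HX = rowsX la lb := by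
  decide +kernel

set_option maxRecDepth 100000 in
/-- INDEX IDENTITY, `Z` side. -/
theorem HZ_eq_rowsZ : A1s_n30_k8_9dee8b31.cert.HZ = rowsZ la lb := by
  decide +kernel

set_option maxRecDepth 100000 in
/-- The certificate's flat `H^X` is `qc.HXFlat`. -/
theorem rowMatrix_HX_eq : rowMatrix 30 A1s_n30_k8_9dee8b31.cert.HX = qc.HXFlat := by
  have cast : ∀ {H H' : List ℕ} (e : H = H'),
      rowMatrix 30 H = (rowMatrix 30 H').submatrix (Fin.cast (congrArg List.length e)) id := by
    intro H H' e; subst e; rfl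
  exact (cast HX_eq_rowsX).trans (rowMatrix_rowsX qc (LA := la) (LB := lb) rfl rfl)

set_option maxRecDepth 100000 in
/-- The certificate's flat `H^Z` is `qc.HZFlat`. -/
theorem rowMatrix_HZ_eq : rowMatrix 30 A1s_n30_k8_9dee8b31.cert.HZ = qc.HZFlat := by
  have cast : ∀ {H H' : List ℕ} (e : H = H'),
      rowMatrix 30 H = (rowMatrix 30 H').submatrix (Fin.cast (congrArg List.length e)) id := by
    intro H H' e; subst e; rfl
  exact (cast HZ_eq_rowsZ).trans (rowMatrix_rowsZ qc (LA := la) (LB := lb) rfl rfl)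

set_option maxRecDepth 100000 in
/-- `d^Z (qc) = 4`, transported from the census certificate (`A1s_n30_k8_9dee8b31.dZ_eq`) by `BB.Code.dZ_eq_of_flat`. -/
theorem qc_dZ : qc.css.dZ = 4 :=
  (qc.dZ_eq_of_flat (D := A1s_n30_k8_9dee8b31.cert.code A1s_n30_k8_9dee8b31.commOK_cert)
    rowMatrix_HX_eq rowMatrix_HZ_eq).symm.trans A1s_n30_k8_9dee8b31.dZ_eq

set_option maxRecDepth 100000 in
/-- `k (qc) = 8`, transported from the census certificate (`A1s_n30_k8_9dee8b31.k_eq`) by `BB.Code.k_eq_of_flat`. -/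
theorem qc_k : qc.k = 8 :=
  (qc.k_eq_of_flat (D := A1s_n30_k8_9dee8b31.cert.code A1s_n30_k8_9dee8b31.commOK_cert)
    rowMatrix_HX_eq rowMatrix_HZ_eq).symm.trans A1s_n30_k8_9dee8b31.k_eq

/-- **`QC(y + y^4 + x^2, y^2 + y^3 + x)` on `ℤ_3 × ℤ_5` has parameters `[[30, 8, 4]]`** (distance exact; `BB.HasParams`) — the census row
`A1s_n30_k8_9dee8b31` read as a statement about the construction. KERNEL. -/
theorem qc_hasParams : Summit.Ventures.QEC.BB.HasParams qc 30 8 4 :=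
  BB.hasParams_of_dZ (by simp only [BB.numQubits_eq]) qc_k qc_dZ

/-- The same in the generic census vocabulary: `qc.css.IsCode 30 8 4`. -/
theorem qc_isCode : qc.css.IsCode 30 8 4 :=
  (BB.hasParams_iff_isCode (by decide)).1 qc_hasParams


set_option maxRecDepth 100000 in
/-- **The Tanner graph of `qc` is connected** (Bravyi et al. 2024 Lemma 3 / `BB.Code.tannerGraph_connected_of_unit_mem`): `x = (1,0)`
and `y = (0,1)` are explicit combinations of exponent differences inside `A` or inside `B` (found by qec-type-05's tools/conn_cert.py,
re-checked by `decide`). Census column «connected» for this row, KERNEL. -/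
theorem qc_tannerGraph_connected : qc.css.tannerGraph.Connected := by
  refine qc.tannerGraph_connected_of_unit_mem (fun h => absurd (congrFun h ((0 : Fin 3), (1 : Fin 5))) (by decide))
    (fun h => absurd (congrFun h ((0 : Fin 3), (2 : Fin 5))) (by decide)) ?_ ?_
  · have e : (((1 : Fin 3), (0 : Fin 5)) : BB.Mono 3 5) = (10 : ℕ) • (((0 : Fin 3), (1 : Fin 5)) - (2, 0)) := by decide
    rw [e]
    exact (AddSubgroup.nsmul_mem _ (qc.sub_mem_expDiffSubgroup_A (by decide) (by decide)) 10)
  · have e : (((0 : Fin 3), (1 : Fin 5)) : BB.Mono 3 5) = (3 : ℕ) • (((0 : Fin 3), (1 : Fin 5)) - (0, 4)) := by decide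
    rw [e]
    exact (AddSubgroup.nsmul_mem _ (qc.sub_mem_expDiffSubgroup_A (by decide) (by decide)) 3)

set_option maxRecDepth 100000 in
/-- **`qc`**: Tanner graph = edge-disjoint union of two layers whose components are wheel graphs `prismGraph 30` (`A₃A₂ᵀ` of order
`15`) and `prismGraph 10` (`B₂B₁ᵀ` of order `5`) — BCGMRY24 Lemma 2 minus planarity (`BB.Code.exists_wheel_layers`). KERNEL. -/
theorem qc_wheel_layers :
    ∃ ΓA ΓB : SimpleGraph ((BB.Mono 3 5 ⊕ BB.Mono 3 5) ⊕ (BB.Mono 3 5 ⊕ BB.Mono 3 5)),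
    qc.css.tannerGraph = ΓA ⊔ ΓB ∧ Disjoint ΓA ΓB ∧
    (∀ K : ΓA.ConnectedComponent, Nonempty (K.toSimpleGraph ≃g prismGraph 30)) ∧
    (∀ K : ΓB.ConnectedComponent, Nonempty (K.toSimpleGraph ≃g prismGraph 10)) := by
  have hA : ∀ g : BB.Mono 3 5, qc.A g ≠ 0 ↔ g = ((0 : Fin 3), (1 : Fin 5)) ∨ g = ((0 : Fin 3), (4 : Fin 5)) ∨ g = ((2 : Fin 3), (0 : Fin 5)) := by decide +kernel
  have hB : ∀ g : BB.Mono 3 5, qc.B g ≠ 0 ↔ g = ((0 : Fin 3), (2 : Fin 5)) ∨ g = ((0 : Fin 3), (3 : Fin 5)) ∨ g = ((1 : Fin 3), (0 : Fin 5)) := by decide +kernel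
  have h := qc.exists_wheel_layers (g₁ := ((0 : Fin 3), (1 : Fin 5))) (g₂ := ((0 : Fin 3), (4 : Fin 5))) (g₃ := ((2 : Fin 3), (0 : Fin 5))) (h₁ := ((0 : Fin 3), (2 : Fin 5)))
    (h₂ := ((0 : Fin 3), (3 : Fin 5))) (h₃ := ((1 : Fin 3), (0 : Fin 5))) (by decide) (by decide) (by decide) (by decide) (by decide) (by decide) hA hB
  have e1 : addOrderOf (((2 : Fin 3), (0 : Fin 5)) - (0, 4)) = 15 := (addOrderOf_eq_iff (by norm_num)).mpr (by decide)
  have e2 : addOrderOf (((0 : Fin 3), (3 : Fin 5)) - (0, 2)) = 5 := (addOrderOf_eq_iff (by norm_num)).mpr (by decide)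
  rw [e1, e2] at h
  exact h

end Summit.Ventures.QEC.Census.A1s_n30_k8_9dee8b31

namespace Summit.Ventures.QEC.Census.A1s_n36_k4_28cc91ab

open Matrix Literature.InformationTheory.QuantumCodes BBRows

/-- Monomials of `A = y + y^5 + x` (certificate `A_terms = [[0, 1], [0, 5], [1, 0]]`). DATA. -/
def la : List (BB.Mono 2 9) := [(Fin.ofNat 2 0, Fin.ofNat 9 1), (Fin.ofNat 2 0, Fin.ofNat 9 5), (Fin.ofNat 2 1, Fin.ofNat 9 0)]

/-- Monomials of `B = y^7 + y^8 + x` (certificate `B_terms = [[0, 7], [0, 8], [1, 0]]`). DATA. -/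
def lb : List (BB.Mono 2 9) := [(Fin.ofNat 2 0, Fin.ofNat 9 7), (Fin.ofNat 2 0, Fin.ofNat 9 8), (Fin.ofNat 2 1, Fin.ofNat 9 0)]

/-- The census row's code as a TYPED two-block code `QC(y + y^5 + x, y^7 + y^8 + x)` on `ℤ_2 × ℤ_9` (`BB.Code 2 9`). (definition) -/
def qc : BB.Code 2 9 := ⟨polyL la, polyL lb⟩

set_option maxRecDepth 100000 in
/-- INDEX IDENTITY, `X` side, in the kernel: the certificate's `H^X` rows ARE the `X`-check words of `qc` (`decide +kernel`). -/
theorem HX_eq_rowsX : A1s_n36_k4_28cc91ab.cert.HX = rowsX la lb := by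
  decide +kernel

set_option maxRecDepth 100000 in
/-- INDEX IDENTITY, `Z` side. -/
theorem HZ_eq_rowsZ : A1s_n36_k4_28cc91ab.cert.HZ = rowsZ la lb := by
  decide +kernel

set_option maxRecDepth 100000 in
/-- The certificate's flat `H^X` is `qc.HXFlat`. -/
theorem rowMatrix_HX_eq : rowMatrix 36 A1s_n36_k4_28cc91ab.cert.HX = qc.HXFlat := by
  have cast : ∀ {H H' : List ℕ} (e : H = H'),
      rowMatrix 36 H = (rowMatrix 36 H').submatrix (Fin.cast (congrArg List.length e)) id := by
    intro H H' e; subst e; rfl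
  exact (cast HX_eq_rowsX).trans (rowMatrix_rowsX qc (LA := la) (LB := lb) rfl rfl)

set_option maxRecDepth 100000 in
/-- The certificate's flat `H^Z` is `qc.HZFlat`. -/
theorem rowMatrix_HZ_eq : rowMatrix 36 A1s_n36_k4_28cc91ab.cert.HZ = qc.HZFlat := by
  have cast : ∀ {H H' : List ℕ} (e : H = H'),
      rowMatrix 36 H = (rowMatrix 36 H').submatrix (Fin.cast (congrArg List.length e)) id := by
    intro H H' e; subst e; rfl
  exact (cast HZ_eq_rowsZ).trans (rowMatrix_rowsZ qc (LA := la) (LB := lb) rfl rfl)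

set_option maxRecDepth 100000 in
/-- `d^Z (qc) = 6`, transported from the census certificate (`A1s_n36_k4_28cc91ab.dZ_eq`) by `BB.Code.dZ_eq_of_flat`. -/
theorem qc_dZ : qc.css.dZ = 6 :=
  (qc.dZ_eq_of_flat (D := A1s_n36_k4_28cc91ab.cert.code A1s_n36_k4_28cc91ab.commOK_cert)
    rowMatrix_HX_eq rowMatrix_HZ_eq).symm.trans A1s_n36_k4_28cc91ab.dZ_eq

set_option maxRecDepth 100000 in
/-- `k (qc) = 4`, transported from the census certificate (`A1s_n36_k4_28cc91ab.k_eq`) by `BB.Code.k_eq_of_flat`. -/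
theorem qc_k : qc.k = 4 :=
  (qc.k_eq_of_flat (D := A1s_n36_k4_28cc91ab.cert.code A1s_n36_k4_28cc91ab.commOK_cert)
    rowMatrix_HX_eq rowMatrix_HZ_eq).symm.trans A1s_n36_k4_28cc91ab.k_eq

/-- **`QC(y + y^5 + x, y^7 + y^8 + x)` on `ℤ_2 × ℤ_9` has parameters `[[36, 4, 6]]`** (distance exact; `BB.HasParams`) — the census row
`A1s_n36_k4_28cc91ab` read as a statement about the construction. KERNEL. -/
theorem qc_hasParams : Summit.Ventures.QEC.BB.HasParams qc 36 4 6 :=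
  BB.hasParams_of_dZ (by simp only [BB.numQubits_eq]) qc_k qc_dZ

/-- The same in the generic census vocabulary: `qc.css.IsCode 36 4 6`. -/
theorem qc_isCode : qc.css.IsCode 36 4 6 :=
  (BB.hasParams_iff_isCode (by decide)).1 qc_hasParams


set_option maxRecDepth 100000 in
/-- **The Tanner graph of `qc` is connected** (Bravyi et al. 2024 Lemma 3 / `BB.Code.tannerGraph_connected_of_unit_mem`): `x = (1,0)`
and `y = (0,1)` are explicit combinations of exponent differences inside `A` or inside `B` (found by qec-type-05's tools/conn_cert.py,
re-checked by `decide`). Census column «connected» for this row, KERNEL. -/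
theorem qc_tannerGraph_connected : qc.css.tannerGraph.Connected := by
  refine qc.tannerGraph_connected_of_unit_mem (fun h => absurd (congrFun h ((0 : Fin 2), (1 : Fin 9))) (by decide))
    (fun h => absurd (congrFun h ((0 : Fin 2), (7 : Fin 9))) (by decide)) ?_ ?_
  · have e : (((1 : Fin 2), (0 : Fin 9)) : BB.Mono 2 9) = (9 : ℕ) • (((0 : Fin 2), (1 : Fin 9)) - (1, 0)) := by decide
    rw [e]
    exact (AddSubgroup.nsmul_mem _ (qc.sub_mem_expDiffSubgroup_A (by decide) (by decide)) 9)
  · have e : (((0 : Fin 2), (1 : Fin 9)) : BB.Mono 2 9) = (2 : ℕ) • (((0 : Fin 2), (1 : Fin 9)) - (0, 5)) := by decide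
    rw [e]
    exact (AddSubgroup.nsmul_mem _ (qc.sub_mem_expDiffSubgroup_A (by decide) (by decide)) 2)

set_option maxRecDepth 100000 in
/-- **`qc`**: Tanner graph = edge-disjoint union of two layers whose components are wheel graphs `prismGraph 36` (`A₃A₂ᵀ` of order
`18`) and `prismGraph 18` (`B₂B₁ᵀ` of order `9`) — BCGMRY24 Lemma 2 minus planarity (`BB.Code.exists_wheel_layers`). KERNEL. -/
theorem qc_wheel_layers :
    ∃ ΓA ΓB : SimpleGraph ((BB.Mono 2 9 ⊕ BB.Mono 2 9) ⊕ (BB.Mono 2 9 ⊕ BB.Mono 2 9)),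
    qc.css.tannerGraph = ΓA ⊔ ΓB ∧ Disjoint ΓA ΓB ∧
    (∀ K : ΓA.ConnectedComponent, Nonempty (K.toSimpleGraph ≃g prismGraph 36)) ∧
    (∀ K : ΓB.ConnectedComponent, Nonempty (K.toSimpleGraph ≃g prismGraph 18)) := by
  have hA : ∀ g : BB.Mono 2 9, qc.A g ≠ 0 ↔ g = ((0 : Fin 2), (1 : Fin 9)) ∨ g = ((0 : Fin 2), (5 : Fin 9)) ∨ g = ((1 : Fin 2), (0 : Fin 9)) := by decide +kernel
  have hB : ∀ g : BB.Mono 2 9, qc.B g ≠ 0 ↔ g = ((0 : Fin 2), (7 : Fin 9)) ∨ g = ((0 : Fin 2), (8 : Fin 9)) ∨ g = ((1 : Fin 2), (0 : Fin 9)) := by decide +kernel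
  have h := qc.exists_wheel_layers (g₁ := ((0 : Fin 2), (1 : Fin 9))) (g₂ := ((0 : Fin 2), (5 : Fin 9))) (g₃ := ((1 : Fin 2), (0 : Fin 9))) (h₁ := ((0 : Fin 2), (7 : Fin 9)))
    (h₂ := ((0 : Fin 2), (8 : Fin 9))) (h₃ := ((1 : Fin 2), (0 : Fin 9))) (by decide) (by decide) (by decide) (by decide) (by decide) (by decide) hA hB
  have e1 : addOrderOf (((1 : Fin 2), (0 : Fin 9)) - (0, 5)) = 18 := (addOrderOf_eq_iff (by norm_num)).mpr (by decide)
  have e2 : addOrderOf (((0 : Fin 2), (8 : Fin 9)) - (0, 7)) = 9 := (addOrderOf_eq_iff (by norm_num)).mpr (by decide)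
  rw [e1, e2] at h
  exact h

end Summit.Ventures.QEC.Census.A1s_n36_k4_28cc91ab
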